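import Literature.Topology.FourManifolds.BCSOrientationGluing
import Literature.Topology.FourManifolds.CompatibleOrientationRestrict
import Literature.Topology.FourManifolds.NullCobordismBoundaryHomology
import Literature.Topology.FourManifolds.HomotopySpheresSignature
import Literature.AlgebraicTopology.SingularHomology.FundamentalClassExistence
import Literature.Topology.FourManifolds.CorkDecompositionSplittingProof
import Literature.AlgebraicTopology.SingularHomology.BoundaryClassNaturality
import HarnessLib

/-!
# Boundary orientations of a boundary connected sum: `b(W_S ♮ W_T) = bW_S # bW_T` (sign pinning)

M. Kervaire, J. Milnor, *Groups of homotopy spheres I*, Ann. of Math. 77 (1963), §2, pp. 507–508: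
for oriented `W₁`, `W₂` with boundary, the boundary connected sum `W = W₁ ♮ W₂` carries the
orientation compatible with `W₁` and `W₂`, and then `bW = bW₁ # bW₂` **as oriented manifolds**.
Homologically (Hatcher 2002, §3.3 p. 253; Spanier Cor. 6.3.10): if the glued relative fundamental
class `w_U` of `W_U` restricts on the piece coming from `W_P` to `u · (w_P)` (`u = ±1`,
`BCSGluing.exists_isRelFundamentalClass`), then its boundary orientation `∂w_U` restricts near the
corresponding boundary points to `u` times the transport of `∂w_P` (locality of the boundary class,
`toLocal_δ_eq_of_two_embeddings_manifold`); and if `∂w_P = incl_* [M_P]_{μ_P}` with `μ_P` compatible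
with the smooth orientation of `M_P`, and the boundary spheres are glued by an orientation
preserving `j' : M_P ⊇ A' → M_U` covering the gluing of the `W`'s, then by naturality of compatible
orientations (`IsCompatible.map_localClass_eq`) the local class of `∂w_U` at `j' s` is `u` times
that of the `o_U`-compatible orientation `μ_U`.

* `Piece.BdryLink` — the sphere-level gluing datum of a piece (`A'`, `j'`, the covering square);
* `Piece.boundaryOrientation_localClass_eq_smul` — the local computation above;
* `Piece.δ_eq_map_fundamentalClass` — for `u = 1`: `∂w_U = incl_* [M_U]_{μ_U}` (`M_U` connected);
* `Piece.units_eq_one` — conversely, once `∂w_U = incl_* [M_U]_{μ_U}` is known, the sign `u` of any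
  other piece is `+1`.

Everything is proved; no named facts.

## References

* M. A. Kervaire, J. W. Milnor, *Groups of homotopy spheres: I*, Ann. of Math. (2) 77 (1963),
  504–537, §2 pp. 507–508. [KervaireMilnorAnnals1963]
* A. Hatcher, *Algebraic Topology*, CUP 2002, §3.3 p. 253. [HatcherAT2002]
-/

noncomputable section

open scoped Manifold ContDiff Topology
open Set Function CategoryTheory CategoryTheory.Limits Topology TopologicalSpace
open Literature.AlgebraicTopology.SingularHomology

namespace Literature.AlgebraicTopology.SingularHomology

variable {X' X : Type} [TopologicalSpace X'] [TopologicalSpace X]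

/-- The restriction to boundaries of an open embedding of pairs is an open embedding. [folklore] -/
theorem isOpenEmbedding_bdryRestrict {B' : Set X'} {B : Set X} {j : X' → X} (hj : IsOpenEmbedding j)
    (hB : ∀ x', x' ∈ B' ↔ j x' ∈ B) : IsOpenEmbedding (bdryRestrict hj.continuous hB) := by
  refine IsOpenEmbedding.of_continuous_injective_isOpenMap (bdryRestrict hj.continuous hB).continuous
    (fun a b h => Subtype.ext (hj.injective (congrArg Subtype.val h))) ?_
  intro V hV
  obtain ⟨V₀, hV₀, rfl⟩ := isOpen_induced_iff.1 hV
  have : (bdryRestrict hj.continuous hB) '' (Subtype.val ⁻¹' V₀) = Subtype.val ⁻¹' (j '' V₀) := by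
    ext y
    constructor
    · rintro ⟨x, hx, rfl⟩
      exact ⟨x.1, hx, rfl⟩
    · rintro ⟨x, hx, hxy⟩
      have hxB : x ∈ B' := (hB x).2 (hxy ▸ y.2)
      exact ⟨⟨x, hxB⟩, hx, Subtype.ext hxy⟩
  rw [this]
  exact (hj.isOpenMap V₀ hV₀).preimage continuous_subtype_val

/-- Induced maps of pairs only depend on the underlying continuous map. [folklore] -/
theorem relativeSingularHomology.map_congr_fun' {R : Type} [CommRing R] {Y : Type} [TopologicalSpace Y]
    {S : Set X} {T : Set Y} {f f' : C(X, Y)} (e : f = f') (h : MapsTo f S T) (h' : MapsTo f' S T)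
    (k : ℕ) : relativeSingularHomology.map R R f h k = relativeSingularHomology.map R R f' h' k := by
  subst e; rfl

/-- Local classes of an orientation at equal points, pushed forward with a common target.
[folklore] -/
theorem HomologicalOrientation.map_localClass_congr_pt {R : Type} [CommRing R] {Y : Type}
    [TopologicalSpace Y] {k : ℕ} (μ : HomologicalOrientation R X k) (f : C(X, Y)) {x₁ x₂ : X}
    (h : x₁ = x₂) {y : Y} (h₁ : MapsTo f ({x₁}ᶜ : Set X) ({y}ᶜ : Set Y))
    (h₂ : MapsTo f ({x₂}ᶜ : Set X) ({y}ᶜ : Set Y)) :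
    relativeSingularHomology.map R R f h₁ k (μ.localClass x₁) =
      relativeSingularHomology.map R R f h₂ k (μ.localClass x₂) := by
  subst h; rfl

end Literature.AlgebraicTopology.SingularHomology

namespace Literature.Topology.FourManifolds

namespace NullCobordism

variable {m : ℕ}
variable {MP : Type} [TopologicalSpace MP] [ChartedSpace (EuclideanSpace ℝ (Fin (m + 1))) MP]
  [IsManifold (𝓡 (m + 1)) ∞ MP] [CompactSpace MP]
variable {MU : Type} [TopologicalSpace MU] [ChartedSpace (EuclideanSpace ℝ (Fin (m + 1))) MU]
  [IsManifold (𝓡 (m + 1)) ∞ MU] [CompactSpace MU]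

namespace Piece

variable {cP : NullCobordism (m + 1) MP} {cU : NullCobordism (m + 1) MU} (P : Piece cP cU)

/-- **Sphere-level gluing datum of a piece**: an open set `A' ⊆ M_P` of the boundary sphere whose
image under `incl_P` lies in the piece, a `C¹` injective immersion `j' : A' → M_U`, and the square
`incl_U ∘ j' = j ∘ incl_P` (Kervaire–Milnor 1963, §2: the gluing of `W₁ ♮ W₂` restricts on the
boundaries to the gluing of `bW₁ # bW₂`). [cite: KervaireMilnorAnnals1963, §2 pp. 507–508] -/
structure BdryLink where
  /-- the open piece of the boundary sphere -/
  A' : Opens MP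
  /-- its gluing map into `M_U` -/
  j' : A' → MU
  incl_mem : ∀ s : A', cP.incl (s : MP) ∈ P.A
  sq : ∀ s : A', cU.incl (j' s) = P.j ⟨cP.incl s, incl_mem s⟩
  contMDiff : ContMDiff (𝓡 (m + 1)) (𝓡 (m + 1)) 1 j'
  injective : Injective j'
  det_ne_zero : ∀ s, LinearMap.det (M := EuclideanSpace ℝ (Fin (m + 1)))
    (mfderiv (𝓡 (m + 1)) (𝓡 (m + 1)) j' s).toLinearMap ≠ 0

variable {P}

/-- The point of the piece under `s ∈ A'`. [folklore] -/
abbrev BdryLink.pt (L : P.BdryLink) (s : L.A') : P.A := ⟨cP.incl s, L.incl_mem s⟩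

omit [IsManifold (𝓡 (m + 1)) ∞ MU] [CompactSpace MU] [CompactSpace MP] [IsManifold (𝓡 (m + 1)) ∞ MP] in
/-- `pt s` is a boundary point of `W_P`. [folklore] -/
theorem BdryLink.pt_mem_boundary (L : P.BdryLink) (s : L.A') :
    ((L.pt s : P.A) : cP.W) ∈ (𝓡∂ (m + 1 + 1)).boundary cP.W := cP.incl_mem_boundary s

omit [IsManifold (𝓡 (m + 1)) ∞ MU] [CompactSpace MU] [CompactSpace MP] [IsManifold (𝓡 (m + 1)) ∞ MP] in
/-- `j (pt s)` is a boundary point of `W_U`. [folklore] -/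
theorem BdryLink.j_pt_mem_boundary (L : P.BdryLink) (s : L.A') :
    P.j (L.pt s) ∈ (𝓡∂ (m + 1 + 1)).boundary cU.W :=
  (P.mem_boundary_iff _).1 (L.pt_mem_boundary s)

/-- The boundary point of `W_U` attached to `s`, as a point of `↥∂W_U`. [folklore] -/
abbrev BdryLink.bpt (L : P.BdryLink) (s : L.A') : ↥((𝓡∂ (m + 1 + 1)).boundary cU.W) :=
  ⟨P.j (L.pt s), L.j_pt_mem_boundary s⟩

variable [T2Space MP] [T2Space MU]

omit [CompactSpace MU] [CompactSpace MP] [IsManifold (𝓡 (m + 1)) ∞ MU] [T2Space MP] [T2Space MU]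
  [IsManifold (𝓡 (m + 1)) ∞ MP] in
/-- `bpt s = e_U (j' s)` for the boundary homeomorphism `e_U : M_U ≅ ∂W_U`. [folklore] -/
theorem BdryLink.bpt_eq (L : P.BdryLink) (s : L.A') : L.bpt s = cU.bdryHomeomorph (L.j' s) :=
  Subtype.ext (L.sq s).symm

omit [CompactSpace MU] [T2Space MU] in
/-- **The boundary orientation of the glued class, computed on a piece** (Kervaire–Milnor 1963,
§2: `bW = bW₁ # bW₂` as oriented manifolds; Hatcher 2002, p. 253). Let `w` be a relative
fundamental class of `W_P` with `∂w = incl_* [M_P]_{μ_P}`, `μ_P` compatible with the smooth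
orientation `o_P`; let `w_U` be a relative fundamental class of `W_U` whose local classes on the
piece are `u · j_* (w|)` (`u = ±1`); let `j' : A' → M_U` be the sphere-level gluing map of the piece,
orientation preserving from `o_P|_{A'}` to `o_U`, and `μ_U` the `o_U`-compatible orientation. Then at
the boundary point `e_U (j' s)` the boundary orientation `∂w_U` has local class `u` times that of
`μ_U` transported by `e_U`. [cite: KervaireMilnorAnnals1963, §2 pp. 507–508] -/
theorem boundaryOrientation_localClass_eq_smul [ConnectedSpace MP] [Nonempty MP]
    (L : P.BdryLink) (g : HomologicalOrientation ℤ (EuclideanSpace ℝ (Fin (m + 1))) (m + 1))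
    {oP : SmoothOrientation (𝓡 (m + 1)) MP} {oU : SmoothOrientation (𝓡 (m + 1)) MU}
    (hop : IsOrientationPreserving (oP.restrict L.A') oU L.j')
    {μP : HomologicalOrientation ℤ MP (m + 1)} {μU : HomologicalOrientation ℤ MU (m + 1)}
    (hμP : SmoothOrientation.IsCompatible g oP μP) (hμU : SmoothOrientation.IsCompatible g oU μU)
    {w : relativeSingularHomology ℤ ℤ cP.W ((𝓡∂ (m + 1 + 1)).boundary cP.W) (m + 1 + 1)}
    (hδ : relativeSingularHomology.δ ℤ ℤ cP.W ((𝓡∂ (m + 1 + 1)).boundary cP.W) (m + 1) w =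
      singularHomology.map ℤ ℤ (boundaryCorestrict (m + 1) cP.inclMap cP.incl_mem_boundary) (m + 1)
        μP.fundamentalClass)
    {wU : relativeSingularHomology ℤ ℤ cU.W ((𝓡∂ (m + 1 + 1)).boundary cU.W) (m + 1 + 1)}
    (hwU : IsRelFundamentalClass ℤ ((𝓡∂ (m + 1 + 1)).boundary cU.W) wU) (u : ℤˣ)
    (hrel : ∀ (x : P.A) (hx : (x : cP.W) ∈ ((𝓡∂ (m + 1 + 1)).boundary cP.W)ᶜ),
      relativeSingularHomology.toLocal ℤ ℤ _ ⟨P.j x, P.j_mem_compl_boundary hx⟩ (m + 1 + 1) wU =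
        (u : ℤ) • relativeSingularHomology.map ℤ ℤ P.j (LocalFamily.mapsTo_compl_pt P.j_injective x)
          (m + 1 + 1) (P.pieceClass w x))
    (s : L.A') :
    (boundaryOrientation ℤ m.succ_ne_zero hwU).localClass (L.bpt s) =
      (u : ℤ) • (μU.comap cU.bdryHomeomorph.symm).localClass (L.bpt s) := by
  classical
  set eP := cP.bdryHomeomorph with heP
  set eU := cU.bdryHomeomorph with heU
  set b : P.A := L.pt s with hb
  have hbP : (b : cP.W) ∈ (𝓡∂ (m + 1 + 1)).boundary cP.W := L.pt_mem_boundary s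
  -- the piece as a manifold with boundary, and the boundary bookkeeping
  haveI : Nonempty P.A := ⟨b⟩
  have hB₁ : ∀ x' : P.A, x' ∈ (𝓡∂ (m + 1 + 1)).boundary P.A ↔
      (P.ι x' : cP.W) ∈ (𝓡∂ (m + 1 + 1)).boundary cP.W := fun x' => mem_boundary_opens_iff P.A x'
  have hB₂ : ∀ x' : P.A, x' ∈ (𝓡∂ (m + 1 + 1)).boundary P.A ↔
      P.j x' ∈ (𝓡∂ (m + 1 + 1)).boundary cU.W := fun x' => (hB₁ x').trans (P.mem_boundary_iff x')
  have hbW' : b ∈ (𝓡∂ (m + 1 + 1)).boundary P.A := (hB₁ b).2 hbP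
  -- (1) locality of the boundary class for the two embeddings `ι`, `j` of the piece
  obtain ⟨β, hβ₁, hβ₂⟩ := toLocal_δ_eq_of_two_embeddings_manifold ℤ ℤ (W' := P.A) hbW'
    P.isOpenEmbedding_ι P.isOpenEmbedding_j hB₁ hB₂ ((u : ℤ) • w) wU (by
      intro h c'
      have hcW' : (c'.center : cP.W) ∈ ((𝓡∂ (m + 1 + 1)).boundary cP.W)ᶜ :=
        fun hc => c'.center_not_mem_B ((hB₁ _).2 hc)
      refine ⟨(u : ℤ) • P.pieceClass w c'.center, ?_, ?_⟩
      · rw [map_zsmul, map_zsmul]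
        congr 1
        exact (P.map_ι_pieceClass_of_mem w c'.center hcW').symm
      · rw [map_zsmul]
        exact hrel c'.center hcW')
  -- (2) the `W_P`-side: `(∂(u w))|_b = u • e_P⁎ (μ_P)_s`
  haveI : CompactSpace ↥((𝓡∂ (m + 1 + 1)).boundary cP.W) :=
    isCompact_iff_compactSpace.1 (ModelWithCorners.isClosed_boundary (I := 𝓡∂ (m + 1 + 1))
      (M := cP.W) (n := 1) one_ne_zero).isCompact
  have heeP : (eP : C(MP, ↥((𝓡∂ (m + 1 + 1)).boundary cP.W))) =
      boundaryCorestrict (m + 1) cP.inclMap cP.incl_mem_boundary := by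
    ext x : 2; rfl
  have meP : MapsTo (eP : C(MP, _)) ({s.1}ᶜ : Set MP)
      ({(⟨P.ι b, (hB₁ b).1 hbW'⟩ : ↥((𝓡∂ (m + 1 + 1)).boundary cP.W))}ᶜ : Set _) :=
    LocalFamily.mapsTo_compl_pt eP.injective s.1
  have hside : singularHomology.toLocal ℤ ℤ (⟨P.ι b, (hB₁ b).1 hbW'⟩ :
      ↥((𝓡∂ (m + 1 + 1)).boundary cP.W)) (m + 1)
        (relativeSingularHomology.δ ℤ ℤ cP.W _ (m + 1) ((u : ℤ) • w)) =
      (u : ℤ) • relativeSingularHomology.map ℤ ℤ (eP : C(MP, _)) meP (m + 1) (μP.localClass s.1) := by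
    rw [map_zsmul, map_zsmul, hδ, ← heeP, singularHomology.toLocal_map_apply' ℤ ℤ _ s.1 _ meP,
      HomologicalOrientation.isFundamentalClass_fundamentalClass_holds (R := ℤ) (X := MP) (m + 1) μP s.1]
  -- (3) the sphere-level piece `A'` and its maps `κ' : A' → ∂W'`, `val'`, `j'`
  let κ' : C(L.A', ↥((𝓡∂ (m + 1 + 1)).boundary P.A)) :=
    ⟨fun s' => ⟨L.pt s', (hB₁ _).2 (L.pt_mem_boundary s')⟩,
      ((cP.continuous_incl.comp continuous_subtype_val).subtype_mk _).subtype_mk _⟩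
  have hκ'inj : Injective κ' := fun a a' h => by
    have h1 : cP.incl a = cP.incl a' := congrArg (fun z : ↥((𝓡∂ (m + 1 + 1)).boundary P.A) =>
      ((z : P.A) : cP.W)) h
    exact Subtype.ext (cP.injective_incl h1)
  let jC : C(L.A', MU) := ⟨L.j', L.contMDiff.continuous⟩
  have R1 : (bdryRestrict P.isOpenEmbedding_ι.continuous hB₁).comp κ' =
      (eP : C(MP, _)).comp (HomologicalOrientation.valC L.A') := by
    ext s' : 2; rfl
  have R2 : (bdryRestrict P.isOpenEmbedding_j.continuous hB₂).comp κ' =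
      (eU : C(MU, _)).comp jC := by
    ext s' : 2
    exact (L.sq s').symm
  -- the restricted orientation of `A'` and naturality of compatibility along `j'`
  set μA := μP.restrictOpens L.A' with hμA
  have hμAc : SmoothOrientation.IsCompatible g (oP.restrict L.A') μA := hμP.restrictOpens L.A'
  have hF1 : relativeSingularHomology.map ℤ ℤ jC (LocalFamily.mapsTo_compl_pt L.injective s)
      (m + 1) (μA.localClass s) = μU.localClass (L.j' s) :=
    SmoothOrientation.IsCompatible.map_localClass_eq g hμAc hμU L.contMDiff.continuous L.injective
      (L.contMDiff.mdifferentiable one_ne_zero) L.det_ne_zero hop s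
  -- (4) identify `β = u • κ'_* (μA)_s`
  have mκ' : MapsTo κ' ({s}ᶜ : Set L.A') ({(⟨b, hbW'⟩ : ↥((𝓡∂ (m + 1 + 1)).boundary P.A))}ᶜ : Set _) :=
    LocalFamily.mapsTo_compl_pt hκ'inj s
  have mres₁ := mapsTo_bdryRestrict P.isOpenEmbedding_ι.continuous P.isOpenEmbedding_ι.injective
    hB₁ hbW'
  have hβ : β = (u : ℤ) • relativeSingularHomology.map ℤ ℤ κ' mκ' (m + 1) (μA.localClass s) := by
    haveI : IsIso (relativeSingularHomology.map ℤ ℤ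
        (bdryRestrict P.isOpenEmbedding_ι.continuous hB₁) mres₁ (m + 1)) :=
      localHomology.isIso_map_of_isOpenEmbedding_of_eq ℤ ℤ
        (bdryRestrict P.isOpenEmbedding_ι.continuous hB₁)
        (isOpenEmbedding_bdryRestrict P.isOpenEmbedding_ι hB₁) ⟨b, hbW'⟩ rfl (m + 1)
    apply (ModuleCat.mono_iff_injective (relativeSingularHomology.map ℤ ℤ
      (bdryRestrict P.isOpenEmbedding_ι.continuous hB₁) mres₁ (m + 1))).1 inferInstance
    have h₁ : MapsTo ((bdryRestrict P.isOpenEmbedding_ι.continuous hB₁).comp κ') ({s}ᶜ : Set L.A')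
        ({(⟨P.ι b, (hB₁ b).1 hbW'⟩ : ↥((𝓡∂ (m + 1 + 1)).boundary cP.W))}ᶜ : Set _) :=
      mres₁.comp mκ'
    have h₁' : MapsTo ((eP : C(MP, _)).comp (HomologicalOrientation.valC L.A')) ({s}ᶜ : Set L.A')
        ({(⟨P.ι b, (hB₁ b).1 hbW'⟩ : ↥((𝓡∂ (m + 1 + 1)).boundary cP.W))}ᶜ : Set _) :=
      meP.comp (LocalFamily.mapsTo_compl_pt Subtype.val_injective s)
    rw [← hβ₁, hside, map_zsmul, ← ModuleCat.comp_apply,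
      ← relativeSingularHomology.map_comp ℤ ℤ κ' _ mκ' mres₁ (m + 1), relativeSingularHomology.map_congr_fun' R1 h₁ h₁' (m + 1),
      relativeSingularHomology.map_comp ℤ ℤ (HomologicalOrientation.valC L.A')
        (eP : C(MP, ↥((𝓡∂ (m + 1 + 1)).boundary cP.W)))
        (LocalFamily.mapsTo_compl_pt Subtype.val_injective s) meP (m + 1),
      ModuleCat.comp_apply, hμA, HomologicalOrientation.map_val_restrictOpens_localClass]
  -- (5) the `W_U`-side
  have mres₂ := mapsTo_bdryRestrict P.isOpenEmbedding_j.continuous P.isOpenEmbedding_j.injective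
    hB₂ hbW'
  have meU : MapsTo (eU : C(MU, _)) ({L.j' s}ᶜ : Set MU) ({L.bpt s}ᶜ : Set _) := by
    rw [L.bpt_eq s]; exact LocalFamily.mapsTo_compl_pt eU.injective _
  have h₂ : MapsTo ((bdryRestrict P.isOpenEmbedding_j.continuous hB₂).comp κ') ({s}ᶜ : Set L.A')
      ({L.bpt s}ᶜ : Set _) := mres₂.comp mκ'
  have h₂' : MapsTo ((eU : C(MU, _)).comp jC) ({s}ᶜ : Set L.A') ({L.bpt s}ᶜ : Set _) :=
    meU.comp (LocalFamily.mapsTo_compl_pt L.injective s)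
  rw [boundaryOrientation_localClass]
  change singularHomology.toLocal ℤ ℤ (⟨P.j b, (hB₂ b).1 hbW'⟩ : ↥((𝓡∂ (m + 1 + 1)).boundary cU.W))
    (m + 1) (relativeSingularHomology.δ ℤ ℤ cU.W _ (m + 1) wU) = _
  rw [hβ₂, hβ, map_zsmul, ← ModuleCat.comp_apply,
    ← relativeSingularHomology.map_comp ℤ ℤ κ' _ mκ' mres₂ (m + 1), relativeSingularHomology.map_congr_fun' R2 h₂ h₂' (m + 1)]
  congr 1
  -- `(e_U ∘ j')_* (μA)_s = e_U⁎ (μ_U)_{j' s} = (μ_U.comap e_U⁻¹)_{bpt s}`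
  rw [relativeSingularHomology.map_comp ℤ ℤ jC (eU : C(MU, ↥((𝓡∂ (m + 1 + 1)).boundary cU.W)))
      (LocalFamily.mapsTo_compl_pt L.injective s) meU (m + 1),
    ModuleCat.comp_apply, hF1, HomologicalOrientation.comap_localClass]
  have hpt : eU.symm (L.bpt s) = L.j' s := by
    rw [Homeomorph.symm_apply_eq]; exact L.bpt_eq s
  have hme : MapsTo (eU : C(MU, ↥((𝓡∂ (m + 1 + 1)).boundary cU.W))) ({eU.symm (L.bpt s)}ᶜ : Set MU)
      ({L.bpt s}ᶜ : Set _) := by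
    rw [hpt]; exact meU
  have hsymm : ((eU.symm.symm : MU ≃ₜ ↥((𝓡∂ (m + 1 + 1)).boundary cU.W)) :
      C(MU, ↥((𝓡∂ (m + 1 + 1)).boundary cU.W))) = (eU : C(MU, ↥((𝓡∂ (m + 1 + 1)).boundary cU.W))) :=
    ContinuousMap.ext fun _ => rfl
  have e1 : (localHomology.mapIso ℤ ℤ eU.symm (L.bpt s) (m + 1)).inv =
      relativeSingularHomology.map ℤ ℤ (eU : C(MU, ↥((𝓡∂ (m + 1 + 1)).boundary cU.W))) hme (m + 1) := by
    change relativeSingularHomology.map ℤ ℤ _ _ (m + 1) = _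
    exact relativeSingularHomology.map_congr_fun' hsymm _ _ _
  have e2 : relativeSingularHomology.map ℤ ℤ (eU : C(MU, ↥((𝓡∂ (m + 1 + 1)).boundary cU.W))) hme
      (m + 1) (μU.localClass (eU.symm (L.bpt s))) =
      (localHomology.mapIso ℤ ℤ eU.symm (L.bpt s) (m + 1)).inv (μU.localClass (eU.symm (L.bpt s))) := by
    rw [e1]
  convert (μU.map_localClass_congr_pt (eU : C(MU, ↥((𝓡∂ (m + 1 + 1)).boundary cU.W))) hpt.symm
    meU hme).trans e2 using 4

omit [IsManifold (𝓡 (m + 1)) ∞ MU] [CompactSpace MU] [T2Space MU] [T2Space MP] in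
/-- The boundary `↥∂W_U` of a null-cobordism of a connected `M_U` is connected. [folklore] -/
theorem connectedSpace_boundary [ConnectedSpace MU] :
    ConnectedSpace ↥((𝓡∂ (m + 1 + 1)).boundary cU.W) :=
  cU.bdryHomeomorph.surjective.connectedSpace cU.bdryHomeomorph.continuous

omit [IsManifold (𝓡 (m + 1)) ∞ MP] [CompactSpace MP] [T2Space MP] [IsManifold (𝓡 (m + 1)) ∞ MU]
  [CompactSpace MU] [T2Space MU] in
/-- `(e_U⁻¹)⁻¹_* = (boundary corestriction of incl_U)_*` on `Hₘ₊₁`. [folklore] -/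
theorem mapIso_bdryHomeomorph_symm_inv :
    (singularHomology.mapIso ℤ ℤ cU.bdryHomeomorph.symm (m + 1)).inv =
      singularHomology.map ℤ ℤ (boundaryCorestrict (m + 1) cU.inclMap cU.incl_mem_boundary) (m + 1) := by
  have hee : ((cU.bdryHomeomorph.symm.symm : MU ≃ₜ ↥((𝓡∂ (m + 1 + 1)).boundary cU.W)) :
      C(MU, ↥((𝓡∂ (m + 1 + 1)).boundary cU.W))) =
      boundaryCorestrict (m + 1) cU.inclMap cU.incl_mem_boundary := by
    ext x : 2; rfl
  change singularHomology.map ℤ ℤ _ (m + 1) = _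
  rw [hee]

/-- **`∂w_U = incl_* [M_U]_{μ_U}` from a piece with `u = 1`** (Kervaire–Milnor 1963, §2: the
orientation of `bW` is that of `bW₁ # bW₂`; `M_U` connected): the boundary orientation of
`w_U` and `μ_U` transported to `↥∂W_U` agree at the point `e_U (j' s₀)`
(`boundaryOrientation_localClass_eq_smul`), hence everywhere (Hatcher 2002, Lemma 3.27 ff.:
`ext_of_connected_holds`), and their fundamental classes are `∂w_U`
(`boundaryOrientation_fundamentalClass_eq`) and `incl_* [M_U]` (`fundamentalClass_comap_holds`).
[cite: KervaireMilnorAnnals1963, §2 pp. 507–508] -/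
theorem δ_eq_map_fundamentalClass [ConnectedSpace MP] [Nonempty MP] [ConnectedSpace MU]
    (L : P.BdryLink) (g : HomologicalOrientation ℤ (EuclideanSpace ℝ (Fin (m + 1))) (m + 1))
    {oP : SmoothOrientation (𝓡 (m + 1)) MP} {oU : SmoothOrientation (𝓡 (m + 1)) MU}
    (hop : IsOrientationPreserving (oP.restrict L.A') oU L.j')
    {μP : HomologicalOrientation ℤ MP (m + 1)} {μU : HomologicalOrientation ℤ MU (m + 1)}
    (hμP : SmoothOrientation.IsCompatible g oP μP) (hμU : SmoothOrientation.IsCompatible g oU μU)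
    {w : relativeSingularHomology ℤ ℤ cP.W ((𝓡∂ (m + 1 + 1)).boundary cP.W) (m + 1 + 1)}
    (hδ : relativeSingularHomology.δ ℤ ℤ cP.W ((𝓡∂ (m + 1 + 1)).boundary cP.W) (m + 1) w =
      singularHomology.map ℤ ℤ (boundaryCorestrict (m + 1) cP.inclMap cP.incl_mem_boundary) (m + 1)
        μP.fundamentalClass)
    {wU : relativeSingularHomology ℤ ℤ cU.W ((𝓡∂ (m + 1 + 1)).boundary cU.W) (m + 1 + 1)}
    (hwU : IsRelFundamentalClass ℤ ((𝓡∂ (m + 1 + 1)).boundary cU.W) wU)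
    (hrel : ∀ (x : P.A) (hx : (x : cP.W) ∈ ((𝓡∂ (m + 1 + 1)).boundary cP.W)ᶜ),
      relativeSingularHomology.toLocal ℤ ℤ _ ⟨P.j x, P.j_mem_compl_boundary hx⟩ (m + 1 + 1) wU =
        relativeSingularHomology.map ℤ ℤ P.j (LocalFamily.mapsTo_compl_pt P.j_injective x)
          (m + 1 + 1) (P.pieceClass w x))
    (s₀ : L.A') :
    relativeSingularHomology.δ ℤ ℤ cU.W ((𝓡∂ (m + 1 + 1)).boundary cU.W) (m + 1) wU =
      singularHomology.map ℤ ℤ (boundaryCorestrict (m + 1) cU.inclMap cU.incl_mem_boundary) (m + 1)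
        μU.fundamentalClass := by
  letI := boundaryTopChartedSpace (n := m + 1) (W := cU.W)
  haveI : CompactSpace ↥((𝓡∂ (m + 1 + 1)).boundary cU.W) :=
    isCompact_iff_compactSpace.1 isCompact_boundary
  haveI := connectedSpace_boundary (cU := cU)
  -- the two orientations of `↥∂W_U` agree at one point, hence everywhere
  have hpt := boundaryOrientation_localClass_eq_smul L g hop hμP hμU hδ hwU 1
    (fun x hx => by rw [hrel x hx, Units.val_one, one_zsmul]) s₀
  rw [Units.val_one, one_zsmul] at hpt
  have heq : boundaryOrientation ℤ m.succ_ne_zero hwU = μU.comap cU.bdryHomeomorph.symm :=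
    HomologicalOrientation.ext_of_connected_holds ℤ (X := ↥((𝓡∂ (m + 1 + 1)).boundary cU.W))
      _ _ (L.bpt s₀) hpt
  rw [← boundaryOrientation_fundamentalClass_eq ℤ m.succ_ne_zero hwU, heq,
    HomologicalOrientation.fundamentalClass_comap_holds (R := ℤ)
      (X := MU) (Y := ↥((𝓡∂ (m + 1 + 1)).boundary cU.W)) (m + 1) μU cU.bdryHomeomorph.symm,
    mapIso_bdryHomeomorph_symm_inv]

/-- **The sign of a piece is `+1` once `∂w_U = incl_* [M_U]_{μ_U}` is known** (Kervaire–Milnor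
1963, §2: both summands of `bW₁ # bW₂` are oriented compatibly with `bW`): the boundary
orientation of `w_U` IS then `μ_U` transported, so at `e_U (j' s)` the relation
`(∂w_U)| = u • (μ_U)|` of `boundaryOrientation_localClass_eq_smul` forces `u = 1`.
[cite: KervaireMilnorAnnals1963, §2 pp. 507–508] -/
theorem units_eq_one [ConnectedSpace MP] [Nonempty MP] [ConnectedSpace MU]
    (L : P.BdryLink) (g : HomologicalOrientation ℤ (EuclideanSpace ℝ (Fin (m + 1))) (m + 1))
    {oP : SmoothOrientation (𝓡 (m + 1)) MP} {oU : SmoothOrientation (𝓡 (m + 1)) MU}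
    (hop : IsOrientationPreserving (oP.restrict L.A') oU L.j')
    {μP : HomologicalOrientation ℤ MP (m + 1)} {μU : HomologicalOrientation ℤ MU (m + 1)}
    (hμP : SmoothOrientation.IsCompatible g oP μP) (hμU : SmoothOrientation.IsCompatible g oU μU)
    {w : relativeSingularHomology ℤ ℤ cP.W ((𝓡∂ (m + 1 + 1)).boundary cP.W) (m + 1 + 1)}
    (hδ : relativeSingularHomology.δ ℤ ℤ cP.W ((𝓡∂ (m + 1 + 1)).boundary cP.W) (m + 1) w =
      singularHomology.map ℤ ℤ (boundaryCorestrict (m + 1) cP.inclMap cP.incl_mem_boundary) (m + 1)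
        μP.fundamentalClass)
    {wU : relativeSingularHomology ℤ ℤ cU.W ((𝓡∂ (m + 1 + 1)).boundary cU.W) (m + 1 + 1)}
    (hwU : IsRelFundamentalClass ℤ ((𝓡∂ (m + 1 + 1)).boundary cU.W) wU)
    (hδU : relativeSingularHomology.δ ℤ ℤ cU.W ((𝓡∂ (m + 1 + 1)).boundary cU.W) (m + 1) wU =
      singularHomology.map ℤ ℤ (boundaryCorestrict (m + 1) cU.inclMap cU.incl_mem_boundary) (m + 1)
        μU.fundamentalClass)
    (u : ℤˣ)
    (hrel : ∀ (x : P.A) (hx : (x : cP.W) ∈ ((𝓡∂ (m + 1 + 1)).boundary cP.W)ᶜ),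
      relativeSingularHomology.toLocal ℤ ℤ _ ⟨P.j x, P.j_mem_compl_boundary hx⟩ (m + 1 + 1) wU =
        (u : ℤ) • relativeSingularHomology.map ℤ ℤ P.j (LocalFamily.mapsTo_compl_pt P.j_injective x)
          (m + 1 + 1) (P.pieceClass w x))
    (s : L.A') : u = 1 := by
  letI := boundaryTopChartedSpace (n := m + 1) (W := cU.W)
  haveI : CompactSpace ↥((𝓡∂ (m + 1 + 1)).boundary cU.W) :=
    isCompact_iff_compactSpace.1 isCompact_boundary
  haveI := connectedSpace_boundary (cU := cU)
  set bO := boundaryOrientation ℤ m.succ_ne_zero hwU with hbO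
  set ν := μU.comap cU.bdryHomeomorph.symm with hν
  -- `bO = ν`: same fundamental class
  have hfc : bO.fundamentalClass = ν.fundamentalClass := by
    rw [hbO, boundaryOrientation_fundamentalClass_eq ℤ m.succ_ne_zero hwU, hδU, hν,
      HomologicalOrientation.fundamentalClass_comap_holds (R := ℤ)
        (X := MU) (Y := ↥((𝓡∂ (m + 1 + 1)).boundary cU.W)) (m + 1) μU cU.bdryHomeomorph.symm,
      mapIso_bdryHomeomorph_symm_inv]
  have heq : bO = ν := by
    ext1; funext x
    rw [← HomologicalOrientation.isFundamentalClass_fundamentalClass_holds (R := ℤ)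
        (X := ↥((𝓡∂ (m + 1 + 1)).boundary cU.W)) (m + 1) bO x,
      ← HomologicalOrientation.isFundamentalClass_fundamentalClass_holds (R := ℤ)
        (X := ↥((𝓡∂ (m + 1 + 1)).boundary cU.W)) (m + 1) ν x, hfc]
  -- at `bpt s`: `ν| = u • ν|`
  have hpt := boundaryOrientation_localClass_eq_smul L g hop hμP hμU hδ hwU u hrel s
  rw [← hbO, heq, ← hν] at hpt
  have h1 := (Int.cast_smul_eq_zsmul ℤ (u : ℤ) (ν.localClass (L.bpt s))).trans hpt.symm
  have h2 : ((u : ℤ) : ℤ) = 1 := ν.eq_one_of_smul_eq (L.bpt s) h1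
  exact Units.val_eq_one.1 (by simpa using h2)

end Piece

end NullCobordism

end Literature.Topology.FourManifolds
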